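import Summits.QuantumFields.GaugeBoot.OrbitAverages
import HarnessLib

/-!
# Gauge-boot: reflection-positivity minors for rectangular Wilson loops on the torus

Cell `pub-gaugeboot` (HOME `run/shared/lean/pub/pub-gaugeboot/`), seat lean1; file 1/2 of the §D
`W(R×T)` packaging (file 2/2 = `WilsonLoopLowerBounds`, the cell's targets).

HONEST FRAMING (page 1 of every file of this cell): certified bounds on lattice expectations at
STATED coupling, gauge group, dimension and torus size; NOT a mass gap, NOT a continuum limit,
NOT a string tension, NOT large `N`. The venture is explicitly NOT Yang–Mills-summit-bearing
(barriers `FixedCouplingUltralocality`, `PerturbativeInvisibility`).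

## Content

Write `h(n, m) = ⟨W_{n×m}⟩_{Λ_L, β}` for the rectangular Wilson loop with `n` links along the axis `0` and
`m` links along a spatial axis `j` (torus `(ℤ/L)^d`, `L` even, compact `G`, continuous `ρ`). The tree's
two reflection-positivity Gram inequalities for rectangles (`gram_wilsonLoop_nonneg_even`: hyperplanes
through sites, any real `β`; `gram_wilsonLoop_nonneg_odd`: hyperplanes between sites, `β ≥ 0`;
Osterwalder–Seiler 1978, Seiler LNP 159 §2) say that the Hankel matrices `[h(s+t, m)]_{s,t}` and
`[h(s+t+1, m)]_{s,t}` are positive semi-definite. This file extracts the `2 × 2` minors, in particular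
those through the corner `h(0, m) = 1`:

* `h(k, m)² ≤ h(2k, m)`, `h(k+1, m)² ≤ h(1, m) · h(2k+1, m)`, `0 ≤ h(2k, m)`, `0 ≤ h(2k+1, m)`;
* the axis exchange `h(n, m) = h(m, n)` (`wilsonExpectation_wilsonLoop_comm`);
* the iteration `wilsonExpectation_wilsonLoop_pow_le`: `h(1, m)^n ≤ h(n, m)` for `n ≤ L` (strong induction:
  even `n = 2k` by the site minor, odd `n = 2k+1` by the link minor), and
  `wilsonExpectation_plaquette_pow_le_wilsonLoop`: `h(1, 1)^{n m} ≤ h(n, m)` for `n, m ≤ L`.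

Everything is a corollary of tree theorems; no certificate, no loop equation, nothing about `L → ∞`.
-/
noncomputable section

open MeasureTheory
open Literature.MathematicalPhysics.QuantumFieldTheory
open Literature.RepresentationTheory.CompactGroups

namespace Summit.QuantumFields.GaugeBoot

/-! ## An elementary extraction of a `2 × 2` minor -/

/-- If the binary quadratic form `A x² + 2 B x + C` is non-negative for all real `x`, then `B² ≤ A C`
(discriminant). [folklore] -/
theorem sq_le_mul_of_forall_quadratic_nonneg {A B C : ℝ} (h : ∀ x : ℝ, 0 ≤ A * x * x + 2 * B * x + C) :
    B ^ 2 ≤ A * C := by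
  have hd := discrim_le_zero (a := A) (b := 2 * B) (c := C) fun x => by
    have := h x
    nlinarith [this]
  unfold discrim at hd
  nlinarith [hd]

/-! ## Rectangles on the torus: the corner `h(0, m) = 1`, the minors, the iteration -/

section Torus

variable {d L N : ℕ} [NeZero d] [NeZero L] {G : Type*} [Group G] [TopologicalSpace G]
  [IsTopologicalGroup G] [CompactSpace G] [MeasurableSpace G] [BorelSpace G]
  (ρ : G →* Matrix (Fin N) (Fin N) ℂ)

omit [NeZero d] [NeZero L] [TopologicalSpace G] [IsTopologicalGroup G] [CompactSpace G]
  [MeasurableSpace G] [BorelSpace G] in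
/-- A rectangle of height `0` is a retraced line: its holonomy is `1`. [folklore] -/
theorem rectangleHolonomy_height_zero (U : GaugeConfig d L G) (x : Site d L) (i j : Fin d) (T : ℕ) :
    rectangleHolonomy U x i j 0 T = 1 := by
  simp [rectangleHolonomy, lineHolonomy]

omit [NeZero d] [NeZero L] [TopologicalSpace G] [IsTopologicalGroup G] [CompactSpace G]
  [MeasurableSpace G] [BorelSpace G] in
/-- `W_{0×T} = 1` pointwise (`N ≥ 1`). [folklore] -/
theorem wilsonLoop_height_zero (hN : N ≠ 0) (x : Site d L) (i j : Fin d) (T : ℕ) (U : GaugeConfig d L G) :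
    wilsonLoop ρ x i j 0 T U = 1 := by
  simp only [wilsonLoop, rectangleHolonomy_height_zero, map_one, Matrix.trace_one, Fintype.card_fin,
    Complex.natCast_re]
  exact inv_mul_cancel₀ (Nat.cast_ne_zero.2 hN)

omit [NeZero d] in
/-- `⟨W_{0×T}⟩ = 1` (`N ≥ 1`, continuous `ρ`: the Wilson measure is a probability measure). [folklore] -/
theorem wilsonExpectation_wilsonLoop_height_zero (hρ : Continuous ρ) (hN : N ≠ 0) (β : ℝ) (x : Site d L)
    (i j : Fin d) (T : ℕ) :
    wilsonExpectation ρ β (wilsonLoop ρ x i j 0 T) = 1 := by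
  haveI := isProbabilityMeasure_wilsonMeasure (d := d) (L := L) (G := G) ρ hρ β
  have h : (wilsonLoop ρ x i j 0 T : GaugeConfig d L G → ℝ) = fun _ => 1 := by
    funext U; exact wilsonLoop_height_zero ρ hN x i j T U
  rw [h]
  simp only [wilsonExpectation, integral_const, smul_eq_mul, mul_one, probReal_univ]

omit [NeZero d] [NeZero L] [MeasurableSpace G] [BorelSpace G] in
/-- **Orientation reversal** of a rectangle does not change the loop variable:
`W(x; j, i; T, R) = W(x; i, j; R, T)` (`Re tr ρ(g⁻¹) = Re tr ρ(g)`). [folklore] -/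
theorem wilsonLoop_symm (hρ : Continuous ρ) (x : Site d L) (i j : Fin d) (R T : ℕ) (U : GaugeConfig d L G) :
    wilsonLoop ρ x j i T R U = wilsonLoop ρ x i j R T U := by
  have h : rectangleHolonomy U x j i T R = (rectangleHolonomy U x i j R T)⁻¹ := by
    unfold rectangleHolonomy; group
  simp only [wilsonLoop, h, CompactGroup.re_trace_map_inv ρ hρ]

omit [NeZero d] in
/-- `|⟨W_{R×T}⟩| ≤ 1` (`|Re tr ρ(g)| ≤ N`). [folklore] -/
theorem abs_wilsonExpectation_wilsonLoop_le_one (hρ : Continuous ρ) (β : ℝ) (x : Site d L) (i j : Fin d)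
    (R T : ℕ) : |wilsonExpectation ρ β (wilsonLoop ρ x i j R T)| ≤ 1 := by
  haveI := isProbabilityMeasure_wilsonMeasure (d := d) (L := L) (G := G) ρ hρ β
  have hbd : ∀ U : GaugeConfig d L G, |wilsonLoop ρ x i j R T U| ≤ 1 := by
    intro U
    unfold wilsonLoop
    have h := CompactGroup.abs_re_trace_le_card ρ hρ (rectangleHolonomy U x i j R T)
    rw [Fintype.card_fin] at h
    rcases Nat.eq_zero_or_pos N with hN | hN
    · subst hN; simp
    · rw [abs_mul, abs_inv, Nat.abs_cast]
      calc (N : ℝ)⁻¹ * |(ρ (rectangleHolonomy U x i j R T)).trace.re| ≤ (N : ℝ)⁻¹ * N := by gcongr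
        _ = 1 := inv_mul_cancel₀ (by exact_mod_cast hN.ne')
  unfold wilsonExpectation
  calc |∫ U, wilsonLoop ρ x i j R T U ∂wilsonMeasure ρ β|
      ≤ ∫ U, |wilsonLoop ρ x i j R T U| ∂wilsonMeasure ρ β := abs_integral_le_integral_abs
    _ ≤ ∫ _U, (1 : ℝ) ∂wilsonMeasure (d := d) (L := L) (G := G) ρ β :=
        integral_mono_of_nonneg (ae_of_all _ fun U => abs_nonneg _) (integrable_const 1)
          (ae_of_all _ fun U => hbd U)
    _ = 1 := by simp

variable {ρ}

/-- **Axis exchange**: `⟨W_{n×m}⟩ = ⟨W_{m×n}⟩` for the rectangles in the `(0, j)` plane (axis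
relabelling by the transposition `(0 j)`, tree `wilsonExpectation_comp_configPerm`, followed by
orientation reversal). [folklore] -/
theorem wilsonExpectation_wilsonLoop_comm (hρ : Continuous ρ) (β : ℝ) {j : Fin d} (hj : j ≠ 0) (n m : ℕ) :
    wilsonExpectation ρ β (wilsonLoop ρ (0 : Site d L) 0 j n m) =
      wilsonExpectation ρ β (wilsonLoop ρ (0 : Site d L) 0 j m n) := by
  have h1 : (wilsonLoop ρ (0 : Site d L) 0 j n m : GaugeConfig d L G → ℝ) = wilsonLoop ρ (0 : Site d L) j 0 m n := by
    funext U; exact wilsonLoop_symm ρ hρ 0 j 0 m n U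
  rw [h1]
  exact wilsonExpectation_wilsonLoop_eq ρ hρ β m n hj.symm hj

/-- The site-plane minor through the corner: for `L` even, `k ≤ L/2` and any real `β`,
`⟨W_{k×m}⟩² ≤ ⟨W_{2k×m}⟩` (`gram_wilsonLoop_nonneg_even` on heights `{0, k}`, `⟨W_{0×m}⟩ = 1`). [folklore] -/
theorem wilsonExpectation_wilsonLoop_sq_le_double (hL : Even L) (hρ : Continuous ρ) (hN : N ≠ 0) (β : ℝ)
    {j : Fin d} (hj : j ≠ 0) {k : ℕ} (hk : k ≤ L / 2) (m : ℕ) :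
    wilsonExpectation ρ β (wilsonLoop ρ (0 : Site d L) 0 j k m) ^ 2 ≤
      wilsonExpectation ρ β (wilsonLoop ρ (0 : Site d L) 0 j (k + k) m) := by
  rcases Nat.eq_zero_or_pos k with hk0 | hk0
  · subst hk0
    rw [wilsonExpectation_wilsonLoop_height_zero ρ hρ hN]
    norm_num
  have h0 := wilsonExpectation_wilsonLoop_height_zero ρ hρ hN β (0 : Site d L) 0 j m
  have hq : ∀ x : ℝ, 0 ≤ 1 * x * x + 2 * wilsonExpectation ρ β (wilsonLoop ρ (0 : Site d L) 0 j k m) * x +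
      wilsonExpectation ρ β (wilsonLoop ρ (0 : Site d L) 0 j (k + k) m) := by
    intro x
    have hS : ∀ a ∈ ({0, k} : Finset ℕ), a ≤ L / 2 := by
      intro a ha
      simp only [Finset.mem_insert, Finset.mem_singleton] at ha
      rcases ha with rfl | rfl <;> omega
    have h := gram_wilsonLoop_nonneg_even ρ hL hρ β hj m {0, k} hS (fun a => if a = 0 then x else 1)
    rw [Finset.sum_pair (Nat.ne_of_gt hk0).symm, Finset.sum_pair (Nat.ne_of_gt hk0).symm,
      Finset.sum_pair (Nat.ne_of_gt hk0).symm] at h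
    simp only [↓reduceIte, Nat.ne_of_gt hk0, zero_add, add_zero, h0] at h
    nlinarith [h]
  have := sq_le_mul_of_forall_quadratic_nonneg hq
  linarith [this]

/-- The link-plane minor through the corner: for `L` even, `β ≥ 0`, `k + 1 ≤ L/2`,
`⟨W_{(k+1)×m}⟩² ≤ ⟨W_{1×m}⟩ · ⟨W_{(2k+1)×m}⟩` (`gram_wilsonLoop_nonneg_odd` on heights `{0, k}`). [folklore] -/
theorem wilsonExpectation_wilsonLoop_sq_le_one_mul (hL : Even L) (hρ : Continuous ρ) {β : ℝ} (hβ : 0 ≤ β)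
    {j : Fin d} (hj : j ≠ 0) {k : ℕ} (hk : k + 1 ≤ L / 2) (m : ℕ) :
    wilsonExpectation ρ β (wilsonLoop ρ (0 : Site d L) 0 j (k + 1) m) ^ 2 ≤
      wilsonExpectation ρ β (wilsonLoop ρ (0 : Site d L) 0 j 1 m) *
        wilsonExpectation ρ β (wilsonLoop ρ (0 : Site d L) 0 j (k + k + 1) m) := by
  rcases Nat.eq_zero_or_pos k with hk0 | hk0
  · subst hk0
    simp only [zero_add, sq, le_refl]
  have hq : ∀ x : ℝ, 0 ≤ wilsonExpectation ρ β (wilsonLoop ρ (0 : Site d L) 0 j 1 m) * x * x +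
      2 * wilsonExpectation ρ β (wilsonLoop ρ (0 : Site d L) 0 j (k + 1) m) * x +
      wilsonExpectation ρ β (wilsonLoop ρ (0 : Site d L) 0 j (k + k + 1) m) := by
    intro x
    have hS : ∀ a ∈ ({0, k} : Finset ℕ), a + 1 ≤ L / 2 := by
      intro a ha
      simp only [Finset.mem_insert, Finset.mem_singleton] at ha
      rcases ha with rfl | rfl <;> omega
    have h := gram_wilsonLoop_nonneg_odd ρ hL hρ hβ hj m {0, k} hS (fun a => if a = 0 then x else 1)
    rw [Finset.sum_pair (Nat.ne_of_gt hk0).symm, Finset.sum_pair (Nat.ne_of_gt hk0).symm,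
      Finset.sum_pair (Nat.ne_of_gt hk0).symm] at h
    simp only [↓reduceIte, Nat.ne_of_gt hk0, zero_add, add_zero] at h
    nlinarith [h]
  exact sq_le_mul_of_forall_quadratic_nonneg hq

/-- `0 ≤ ⟨W_{(2k+1)×m}⟩` for `L` even, `β ≥ 0`, `k + 1 ≤ L/2` (diagonal of the link-plane Gram
matrix). [folklore] -/
theorem wilsonExpectation_wilsonLoop_nonneg_odd' (hL : Even L) (hρ : Continuous ρ) {β : ℝ} (hβ : 0 ≤ β)
    {j : Fin d} (hj : j ≠ 0) {k : ℕ} (hk : k + 1 ≤ L / 2) (m : ℕ) :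
    0 ≤ wilsonExpectation ρ β (wilsonLoop ρ (0 : Site d L) 0 j (k + k + 1) m) := by
  have h := gram_wilsonLoop_nonneg_odd ρ hL hρ hβ hj m {k} (by simpa using hk) (fun _ => 1)
  simpa using h

/-- `0 ≤ ⟨W_{2k×m}⟩` for `L` even, any real `β`, `k ≤ L/2` (diagonal of the site-plane Gram matrix).
[folklore] -/
theorem wilsonExpectation_wilsonLoop_nonneg_even' (hL : Even L) (hρ : Continuous ρ) (β : ℝ)
    {j : Fin d} (hj : j ≠ 0) {k : ℕ} (hk : k ≤ L / 2) (m : ℕ) :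
    0 ≤ wilsonExpectation ρ β (wilsonLoop ρ (0 : Site d L) 0 j (k + k) m) := by
  have h := gram_wilsonLoop_nonneg_even ρ hL hρ β hj m {k} (by simpa using hk) (fun _ => 1)
  simpa using h

/-- `0 ≤ ⟨W_{1×m}⟩` for `L` even and `β ≥ 0`. [folklore] -/
theorem wilsonExpectation_wilsonLoop_one_nonneg (hL : Even L) (hρ : Continuous ρ) {β : ℝ} (hβ : 0 ≤ β)
    {j : Fin d} (hj : j ≠ 0) (m : ℕ) :
    0 ≤ wilsonExpectation ρ β (wilsonLoop ρ (0 : Site d L) 0 j 1 m) := by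
  have h2 : 2 ≤ L := by
    obtain ⟨r, hr⟩ := hL
    have := NeZero.ne L
    omega
  have h := wilsonExpectation_wilsonLoop_nonneg_odd' (d := d) hL hρ hβ hj (k := 0) (by omega) m
  simpa using h

/-- **Area-power lower bound along one axis**: for `L` even, `β ≥ 0`, `N ≥ 1` and `n ≤ L`,
`⟨W_{1×m}⟩^n ≤ ⟨W_{n×m}⟩` (strong induction on `n`: even `n = 2k` by the site minor
`⟨W_k⟩² ≤ ⟨W_{2k}⟩`, odd `n = 2k+1` by the link minor `⟨W_{k+1}⟩² ≤ ⟨W_1⟩⟨W_{2k+1}⟩`). [folklore] -/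
theorem wilsonExpectation_wilsonLoop_pow_le (hL : Even L) (hρ : Continuous ρ) (hN : N ≠ 0) {β : ℝ}
    (hβ : 0 ≤ β) {j : Fin d} (hj : j ≠ 0) (m : ℕ) :
    ∀ n : ℕ, n ≤ L →
      wilsonExpectation ρ β (wilsonLoop ρ (0 : Site d L) 0 j 1 m) ^ n ≤
        wilsonExpectation ρ β (wilsonLoop ρ (0 : Site d L) 0 j n m) := by
  have hev := Nat.even_iff.mp hL
  set u := wilsonExpectation ρ β (wilsonLoop ρ (0 : Site d L) 0 j 1 m) with hu
  have hu0 : 0 ≤ u := wilsonExpectation_wilsonLoop_one_nonneg hL hρ hβ hj m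
  intro n
  induction n using Nat.strong_induction_on with
  | _ n ih =>
    intro hn
    rcases Nat.lt_or_ge n 2 with hn2 | hn2
    · interval_cases n
      · rw [pow_zero, wilsonExpectation_wilsonLoop_height_zero ρ hρ hN]
      · rw [pow_one]
    rcases Nat.even_or_odd n with ⟨k, hk⟩ | ⟨k, hk⟩
    · -- `n = k + k`, `1 ≤ k`
      have hk1 : 1 ≤ k := by omega
      have ihk := ih k (by omega) (by omega)
      have hsq := wilsonExpectation_wilsonLoop_sq_le_double hL hρ hN β hj (k := k) (by omega) m
      rw [hk, show u ^ (k + k) = (u ^ k) ^ 2 by ring]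
      calc (u ^ k) ^ 2 ≤ wilsonExpectation ρ β (wilsonLoop ρ (0 : Site d L) 0 j k m) ^ 2 :=
            pow_le_pow_left₀ (pow_nonneg hu0 k) ihk 2
        _ ≤ _ := hsq
    · -- `n = 2k + 1`, `1 ≤ k`
      have hk1 : 1 ≤ k := by omega
      have ihk := ih (k + 1) (by omega) (by omega)
      have hkL : k + 1 ≤ L / 2 := by omega
      have hsq := wilsonExpectation_wilsonLoop_sq_le_one_mul hL hρ hβ hj hkL m
      have hpos := wilsonExpectation_wilsonLoop_nonneg_odd' hL hρ hβ hj hkL m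
      rw [hk, show 2 * k + 1 = k + k + 1 by ring]
      rcases hu0.eq_or_lt with hu00 | hupos
      · rw [← hu00, zero_pow (by omega)]
        exact hpos
      · -- `u^(2k+1) · u = (u^(k+1))² ≤ ⟨W_{k+1}⟩² ≤ u · ⟨W_{2k+1}⟩`
        have h1 : (u ^ (k + 1)) ^ 2 ≤ wilsonExpectation ρ β (wilsonLoop ρ (0 : Site d L) 0 j (k + 1) m) ^ 2 :=
          pow_le_pow_left₀ (pow_nonneg hu0 (k + 1)) ihk 2
        have h2 : u ^ (k + k + 1) * u ≤ wilsonExpectation ρ β (wilsonLoop ρ (0 : Site d L) 0 j (k + k + 1) m) * u := by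
          calc u ^ (k + k + 1) * u = (u ^ (k + 1)) ^ 2 := by ring
            _ ≤ _ := h1.trans hsq
            _ = _ := by rw [hu]; ring
        exact le_of_mul_le_mul_right h2 hupos

/-- **Area-power lower bound** on the torus: for `L` even, `β ≥ 0`, `N ≥ 1`, a spatial axis `j ≠ 0`
and `n, m ≤ L`, `⟨W_{1×1}⟩^{n m} ≤ ⟨W_{n×m}⟩` (the previous bound along each axis and the axis
exchange). [folklore] -/
theorem wilsonExpectation_plaquette_pow_le_wilsonLoop (hL : Even L) (hρ : Continuous ρ) (hN : N ≠ 0)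
    {β : ℝ} (hβ : 0 ≤ β) {j : Fin d} (hj : j ≠ 0) {n m : ℕ} (hn : n ≤ L) (hm : m ≤ L) :
    wilsonExpectation ρ β (wilsonLoop ρ (0 : Site d L) 0 j 1 1) ^ (n * m) ≤
      wilsonExpectation ρ β (wilsonLoop ρ (0 : Site d L) 0 j n m) := by
  have hu0 : 0 ≤ wilsonExpectation ρ β (wilsonLoop ρ (0 : Site d L) 0 j 1 1) :=
    wilsonExpectation_wilsonLoop_one_nonneg hL hρ hβ hj 1
  -- along axis `0` at width `1`: `u^m ≤ ⟨W_{m×1}⟩ = ⟨W_{1×m}⟩`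
  have hm' := wilsonExpectation_wilsonLoop_pow_le hL hρ hN hβ hj 1 m hm
  rw [wilsonExpectation_wilsonLoop_comm hρ β hj m 1] at hm'
  -- along axis `0` at width `m`
  have hn' := wilsonExpectation_wilsonLoop_pow_le hL hρ hN hβ hj m n hn
  rw [mul_comm n m, pow_mul]
  exact (pow_le_pow_left₀ (pow_nonneg hu0 m) hm' n).trans hn'

/-- The general site-plane minor: for `L` even, any real `β`, heights `a, b ≤ L/2`,
`⟨W_{(a+b)×m}⟩² ≤ ⟨W_{2a×m}⟩ · ⟨W_{2b×m}⟩`. [folklore] -/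
theorem wilsonExpectation_wilsonLoop_sq_le_even (hL : Even L) (hρ : Continuous ρ) (β : ℝ)
    {j : Fin d} (hj : j ≠ 0) {a b : ℕ} (ha : a ≤ L / 2) (hb : b ≤ L / 2) (m : ℕ) :
    wilsonExpectation ρ β (wilsonLoop ρ (0 : Site d L) 0 j (a + b) m) ^ 2 ≤
      wilsonExpectation ρ β (wilsonLoop ρ (0 : Site d L) 0 j (a + a) m) *
        wilsonExpectation ρ β (wilsonLoop ρ (0 : Site d L) 0 j (b + b) m) := by
  rcases eq_or_ne a b with rfl | hab
  · rw [sq]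
  have hq : ∀ x : ℝ, 0 ≤ wilsonExpectation ρ β (wilsonLoop ρ (0 : Site d L) 0 j (a + a) m) * x * x +
      2 * wilsonExpectation ρ β (wilsonLoop ρ (0 : Site d L) 0 j (a + b) m) * x +
      wilsonExpectation ρ β (wilsonLoop ρ (0 : Site d L) 0 j (b + b) m) := by
    intro x
    have hS : ∀ c ∈ ({a, b} : Finset ℕ), c ≤ L / 2 := by
      intro c hc
      simp only [Finset.mem_insert, Finset.mem_singleton] at hc
      rcases hc with rfl | rfl <;> omega
    have h := gram_wilsonLoop_nonneg_even ρ hL hρ β hj m {a, b} hS (fun c => if c = a then x else 1)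
    rw [Finset.sum_pair hab, Finset.sum_pair hab, Finset.sum_pair hab] at h
    simp only [↓reduceIte, hab.symm, Nat.add_comm b a] at h
    nlinarith [h]
  exact sq_le_mul_of_forall_quadratic_nonneg hq

/-- The general link-plane minor: for `L` even, `β ≥ 0`, heights `a + 1, b + 1 ≤ L/2`,
`⟨W_{(a+b+1)×m}⟩² ≤ ⟨W_{(2a+1)×m}⟩ · ⟨W_{(2b+1)×m}⟩`. [folklore] -/
theorem wilsonExpectation_wilsonLoop_sq_le_odd (hL : Even L) (hρ : Continuous ρ) {β : ℝ} (hβ : 0 ≤ β)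
    {j : Fin d} (hj : j ≠ 0) {a b : ℕ} (ha : a + 1 ≤ L / 2) (hb : b + 1 ≤ L / 2) (m : ℕ) :
    wilsonExpectation ρ β (wilsonLoop ρ (0 : Site d L) 0 j (a + b + 1) m) ^ 2 ≤
      wilsonExpectation ρ β (wilsonLoop ρ (0 : Site d L) 0 j (a + a + 1) m) *
        wilsonExpectation ρ β (wilsonLoop ρ (0 : Site d L) 0 j (b + b + 1) m) := by
  rcases eq_or_ne a b with rfl | hab
  · rw [sq]
  have hq : ∀ x : ℝ, 0 ≤ wilsonExpectation ρ β (wilsonLoop ρ (0 : Site d L) 0 j (a + a + 1) m) * x * x +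
      2 * wilsonExpectation ρ β (wilsonLoop ρ (0 : Site d L) 0 j (a + b + 1) m) * x +
      wilsonExpectation ρ β (wilsonLoop ρ (0 : Site d L) 0 j (b + b + 1) m) := by
    intro x
    have hS : ∀ c ∈ ({a, b} : Finset ℕ), c + 1 ≤ L / 2 := by
      intro c hc
      simp only [Finset.mem_insert, Finset.mem_singleton] at hc
      rcases hc with rfl | rfl <;> omega
    have h := gram_wilsonLoop_nonneg_odd ρ hL hρ hβ hj m {a, b} hS (fun c => if c = a then x else 1)
    rw [Finset.sum_pair hab, Finset.sum_pair hab, Finset.sum_pair hab] at h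
    simp only [↓reduceIte, hab.symm, Nat.add_comm b a] at h
    nlinarith [h]
  exact sq_le_mul_of_forall_quadratic_nonneg hq

end Torus

end Summit.QuantumFields.GaugeBoot

end
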